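import Summits.BirchSwinnertonDyer.BirchSwinnertonDyer.Theorems.ResidualThetaTransportAtTwoSignedMuVanishingAtTwoPlusNeronMuChild
import Summits.BirchSwinnertonDyer.BirchSwinnertonDyer.Theorems.ThetaPartnerAtTwoSignedTransportAtTwoSelmerPontryagin
import HarnessLib

/-!
# Route `ResidualThetaTransportAtTwo`, crux Kμ⁺ `SignedMuVanishingAtTwoPlus` (stmt-BirchSwinnertonDyer-20689):
# the ALGEBRAIC half and its children in SELMER-GROUP currency — «`Sel⁺(W/ℚ_∞)[2]` is finite» —
# the one object Greenberg–Vatsal / B. D. Kim transport, shared with route `ThetaPartnerAtTwo`'s stub `sel2`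

Cell `bsd-wall`, width seat `bsd-wall-rtt-p4-w2` on the lead line `birth` (skeleton v3: algebraic stub
`stub_signedResidualFiniteAtTwo` = «`X⁺/2X⁺` finite»; ledger children 21438 seed / 21439–22891 propagation).
THEOREMS ONLY (no `def`, no named fact, no `sorry`); helper `--supports` the crux; nothing about any curve is
asserted and BSD is not proved by this. Inputs BY NAME: the lead's p570516 `…Residual`
(`isTorsion_and_mu_eq_zero_iff_finite_quotient`: torsion ∧ `μ = 0` ⟺ `X/pX` finite, for f.g. `X`), the sibling
route's `SignedTransportAtTwo.finite_quotient_augIdealP_iff_finite_pTorsion` (tp2-p1: `X^ε/(p)X^ε` finite ⟺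
`Sel^ε(E/K_∞)[p]` finite, Pontryagin, NO finite-generation hypothesis), and this seat's p579652 `…NeronMuChild`
(crux ⟺ RESID ∧ NÉRON-`μ`).

* §1 `isTorsion_and_mu_eq_zero_iff_finite_selmer_pTorsion` — datum-wise, any number field / prime / sign: for a
  signed dual datum `D` with `X` finitely generated, «`X` torsion ∧ `μ(X) = 0`» ⟺ «`Sel^ε(E/K_∞)[p]` finite».
* §2 `muAlgebraic_iff_sel2Finite` — the algebraic conjunct of Kμ⁺ on the habitat⁺ ⟺ **SEL2**: «for every
  cyclotomic `κ, γ`: if `X⁺(W/ℚ_∞)` is finitely generated (some datum), then `Sel⁺(W/ℚ_∞)[2]` is finite»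
  (no dual datum in the conclusion); with p579652: **Kμ⁺ ⟺ SEL2 ∧ NÉRON-`μ`**
  (`signedMuVanishingAtTwoPlus_iff_sel2Finite_and_padicValRat_add_mu_eq_zero`).
* §3 the children in the same currency: `signedMuPropagationAtTwoR_of_sel2Transfer` (22891) and
  `signedMuPropagationAtTwo_of_sel2Transfer` (21439, wide) from a SEL2-TRANSFER «finiteness of `Sel⁺(·/ℚ_∞)[2]`
  passes from `A` to `W` along `W[2] ≃ A[2]`» (GV Prop. (2.8) / Kim Prop. 2.9–2.12 shape read at `2` — the SAME
  binder shape as `ThetaPartnerAtTwo`'s `sel2`, so ONE research statement serves both routes);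
  `signedMuSeedAtTwoPlus_of_sel2Seed` (21438); and NECESSITY `signedMuSeedAtTwoPlus_of_signedMuVanishingAtTwoPlus`
  — the seed child is implied by the crux itself (`A := W`), so of the split {21437, 21438, 21439} only the
  propagation child is not a consequence of the parent.

References: R. Greenberg, V. Vatsal, Invent. Math. 142 (2000) p. 3 and Prop. (2.8) [GreenbergVatsal2000];
B. D. Kim, Compositio Math. 145 (2009) Prop. 2.10, Cor. 2.13 [BDKim2009]; R. Greenberg, LNM 1716 (1999) §1
[Greenberg1999LNM]; S. Kobayashi, Invent. Math. 152 (2003) Def. 1.1 [Kobayashi2003].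
-/

set_option autoImplicit false
set_option linter.dupNamespace false

noncomputable section

open scoped Classical MatrixGroups ModularForm

open CongruenceSubgroup WeierstrassCurve Literature.NumberTheory.EllipticCurves
  Literature.NumberTheory.EllipticCurves.ModularForms Literature.NumberTheory.EllipticCurves.IwasawaAlgebra
  Literature.NumberTheory.EllipticCurves.Rank1Residual Literature.NumberTheory.EllipticCurves.Kobayashi2003
  Summit.BirchSwinnertonDyer.Rank1Residual.Supersingular Summit.BirchSwinnertonDyer.Rank1Residual.X1
  Summit.BirchSwinnertonDyer.BirchSwinnertonDyer.Theses.ResidualThetaTransportAtTwo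

namespace Summit.BirchSwinnertonDyer.BirchSwinnertonDyer.Theorems.SignedMuAtTwo

universe u

/-! ## §1. One datum: torsion ∧ `μ = 0` ⟺ `Sel^ε(E/K_∞)[p]` finite -/

/-- **Datum-wise, in Selmer-group currency**: for a signed Selmer dual datum `D` with `X = D.X` finitely generated
over `Λ`, «`X` is `Λ`-torsion with `μ(X) = 0`» iff «the `p`-torsion `Sel^ε(E/K_∞)[p]` of Kobayashi's signed Selmer
GROUP is finite» (`X/pX` finite ⟺ both, by the lead's `Λ`-algebra and the sibling route's Pontryagin step).
[cite: GreenbergVatsal2000, p. 3 (proof of Thm. (1.4))] [cite: Greenberg1999LNM, §1 (p. 60)] -/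
theorem isTorsion_and_mu_eq_zero_iff_finite_selmer_pTorsion {K : Type u} [Field K] [NumberField K] {p : ℕ}
    [Fact p.Prime] {W : WeierstrassCurve K} {κ : ZpExtension K p} {γ : Field.absoluteGaloisGroup K} {ε : ℤˣ}
    (D : SignedSelmerDualData W κ γ ε) [Module.Finite (IwasawaAlgebra p) D.X] :
    (Module.IsTorsion (IwasawaAlgebra p) D.X ∧ D.mu = 0) ↔ {s : signedSelmerInfty W κ ε | p • s = 0}.Finite :=
  (isTorsion_and_mu_eq_zero_iff_finite_quotient D).trans
    (SignedTransportAtTwo.finite_quotient_augIdealP_iff_finite_pTorsion D)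

/-! ## §2. The algebraic conjunct of Kμ⁺ ⟺ SEL2 -/

/-- **The algebraic conjunct of Kμ⁺ on the habitat⁺ ⟺ SEL2**: «for every habitat⁺ curve `W` and cyclotomic
`κ, γ`: if the `+` signed Selmer dual `X⁺(W/ℚ_∞)` is finitely generated (for some, equivalently any, datum), then
`Sel⁺(W/ℚ_∞)[2]` is finite». [cite: GreenbergVatsal2000, p. 3 (proof of Thm. (1.4))] [cite: Greenberg1999LNM, §1 (p. 60)] -/
theorem muAlgebraic_iff_sel2Finite :
    (∀ (W : WeierstrassCurve ℚ) [W.IsElliptic] [W.IsGloballyMinimal], ¬ W.HasCM → W.analyticRank = 0 →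
      GoodSS W 2 → W.frobeniusTrace 2 = 0 → W.Δ < 0 →
      ∀ (κ : ZpExtension ℚ 2) (γ : Field.absoluteGaloisGroup ℚ), κ.IsCyclotomic → κ.IsTopGenerator γ →
      ∀ (D : SignedSelmerDualData W κ γ 1) [Module.Finite (IwasawaAlgebra 2) D.X],
        Module.IsTorsion (IwasawaAlgebra 2) D.X ∧ D.mu = 0) ↔
    (∀ (W : WeierstrassCurve ℚ) [W.IsElliptic] [W.IsGloballyMinimal], ¬ W.HasCM → W.analyticRank = 0 →
      GoodSS W 2 → W.frobeniusTrace 2 = 0 → W.Δ < 0 →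
      ∀ (κ : ZpExtension ℚ 2) (γ : Field.absoluteGaloisGroup ℚ), κ.IsCyclotomic → κ.IsTopGenerator γ →
      (∃ D : SignedSelmerDualData W κ γ 1, Module.Finite (IwasawaAlgebra 2) D.X) →
      {s : signedSelmerInfty W κ 1 | 2 • s = 0}.Finite) := by
  constructor
  · rintro h W _ _ hCM hr hss ha hΔ κ γ hκ hγ ⟨D, hD⟩
    exact (isTorsion_and_mu_eq_zero_iff_finite_selmer_pTorsion D).mp (h W hCM hr hss ha hΔ κ γ hκ hγ D)
  · intro h W _ _ hCM hr hss ha hΔ κ γ hκ hγ D hD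
    exact (isTorsion_and_mu_eq_zero_iff_finite_selmer_pTorsion D).mpr (h W hCM hr hss ha hΔ κ γ hκ hγ ⟨D, hD⟩)

/-- **Kμ⁺ ⟺ SEL2 ∧ NÉRON-`μ`** (kernel-exact, no print fact): the crux holds iff (SEL2) for every habitat⁺ curve and
cyclotomic `κ, γ` with `X⁺(W/ℚ_∞)` finitely generated, `Sel⁺(W/ℚ_∞)[2]` is finite, AND (NÉRON-`μ`) `v₂(ϖ) + μ(L♭) = 0`
for every habitat⁺ `(W, f, ϖ, L♯, L♭)` (this seat's p579652). [cite: GreenbergVatsal2000, p. 2–3] [cite: Pollack2003, Prop. 6.18] -/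
theorem signedMuVanishingAtTwoPlus_iff_sel2Finite_and_padicValRat_add_mu_eq_zero :
    SignedMuVanishingAtTwoPlus ↔
      (∀ (W : WeierstrassCurve ℚ) [W.IsElliptic] [W.IsGloballyMinimal], ¬ W.HasCM → W.analyticRank = 0 →
        GoodSS W 2 → W.frobeniusTrace 2 = 0 → W.Δ < 0 →
        ∀ (κ : ZpExtension ℚ 2) (γ : Field.absoluteGaloisGroup ℚ), κ.IsCyclotomic → κ.IsTopGenerator γ →
        (∃ D : SignedSelmerDualData W κ γ 1, Module.Finite (IwasawaAlgebra 2) D.X) →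
        {s : signedSelmerInfty W κ 1 | 2 • s = 0}.Finite) ∧
      (∀ (W : WeierstrassCurve ℚ) [W.IsElliptic] [W.IsGloballyMinimal], ¬ W.HasCM →
        W.analyticRank = 0 → GoodSS W 2 → W.frobeniusTrace 2 = 0 → W.Δ < 0 →
        ∀ [NeZero (W.conductorNorm ℤ)] (f : CuspForm (Gamma0 (W.conductorNorm ℤ)) 2), IsNewformOf W f →
        ∀ (ϖ : ℚ), (ϖ : ℝ) * W.realPeriodRat = plusPeriod f →
        ∀ (Lplus Lminus : IwasawaAlgebra 2), IsPollackPair f 2 Lplus Lminus →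
        padicValRat 2 ϖ + MuLambda.mu Lminus = 0) := by
  rw [← muAlgebraic_iff_sel2Finite]
  constructor
  · intro h
    exact ⟨fun W _ _ hCM hr hss ha hΔ ↦ (h W hCM hr hss ha hΔ).1,
      signedMuAnalyticAtTwoPlus_iff_padicValRat_add_mu_eq_zero.mp (signedMuAnalyticAtTwoPlus_of_signedMuVanishingAtTwoPlus h)⟩
  · rintro ⟨halg, hν⟩ W _ _ hCM hr hss ha hΔ
    exact ⟨halg W hCM hr hss ha hΔ, signedMuAnalyticAtTwoPlus_iff_padicValRat_add_mu_eq_zero.mpr hν W hCM hr hss ha hΔ⟩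

/-! ## §3. The children 21438 / 21439 / 22891 in Selmer-group currency, and necessity of the seed -/

/-- **SEL2-TRANSFER ⇒ `SignedMuPropagationAtTwoR`** (child 22891, `Δ_W < 0`): if, for good-supersingular `a₂ = 0`
curves `W, A` with `Δ_W < 0` and `W[2] ≃ A[2]` Galois-equivariantly, at every cyclotomic `(κ, γ)` the implication
«`X⁺(A)` f.g. ⇒ `Sel⁺(A/ℚ_∞)[2]` finite» gives «`X⁺(W)` f.g. ⇒ `Sel⁺(W/ℚ_∞)[2]` finite» (GV Prop. (2.8) / Kim
Prop. 2.9–2.12 read at `2`, through `Sel⁺(ℚ_∞, W[2]) = Sel⁺(ℚ_∞, A[2])`), then torsion with `μ = 0` propagates.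
[cite: GreenbergVatsal2000, Prop. (2.8)] [cite: BDKim2009, Prop. 2.10 and Cor. 2.13] -/
theorem signedMuPropagationAtTwoR_of_sel2Transfer
    (hsel2 : ∀ (W : WeierstrassCurve ℚ) [W.IsElliptic] [W.IsGloballyMinimal] (A : WeierstrassCurve ℚ)
      [A.IsElliptic] [A.IsGloballyMinimal], GoodSS W 2 → W.frobeniusTrace 2 = 0 → W.Δ < 0 → GoodSS A 2 →
      A.frobeniusTrace 2 = 0 →
      (∃ e : WeierstrassCurve.geomTorsion W (2 : ℤ) ≃+ WeierstrassCurve.geomTorsion A (2 : ℤ),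
        ∀ (σ : Field.absoluteGaloisGroup ℚ) (P : WeierstrassCurve.geomTorsion W (2 : ℤ)), e (σ • P) = σ • e P) →
      ∀ (κ : ZpExtension ℚ 2) (γ : Field.absoluteGaloisGroup ℚ), κ.IsCyclotomic → κ.IsTopGenerator γ →
      ((∃ D' : SignedSelmerDualData A κ γ 1, Module.Finite (IwasawaAlgebra 2) D'.X) →
        {s : signedSelmerInfty A κ 1 | 2 • s = 0}.Finite) →
      (∃ D : SignedSelmerDualData W κ γ 1, Module.Finite (IwasawaAlgebra 2) D.X) →
      {s : signedSelmerInfty W κ 1 | 2 • s = 0}.Finite) :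
    SignedMuPropagationAtTwoR := by
  intro W _ _ A _ _ hssW haW hΔ hssA haA hiso hA κ γ hκ hγ D hD
  refine (isTorsion_and_mu_eq_zero_iff_finite_selmer_pTorsion D).mpr
    (hsel2 W A hssW haW hΔ hssA haA hiso κ γ hκ hγ ?_ ⟨D, hD⟩)
  rintro ⟨D', hD'⟩
  exact (isTorsion_and_mu_eq_zero_iff_finite_selmer_pTorsion D').mp (hA κ γ hκ hγ D')

/-- **SEL2-TRANSFER (wide) ⇒ `SignedMuPropagationAtTwo`** (child 21439, no sign condition on `Δ_W`).
[cite: GreenbergVatsal2000, Prop. (2.8)] [cite: BDKim2009, Prop. 2.10 and Cor. 2.13] -/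
theorem signedMuPropagationAtTwo_of_sel2Transfer
    (hsel2 : ∀ (W : WeierstrassCurve ℚ) [W.IsElliptic] [W.IsGloballyMinimal] (A : WeierstrassCurve ℚ)
      [A.IsElliptic] [A.IsGloballyMinimal], GoodSS W 2 → W.frobeniusTrace 2 = 0 → GoodSS A 2 →
      A.frobeniusTrace 2 = 0 →
      (∃ e : WeierstrassCurve.geomTorsion W (2 : ℤ) ≃+ WeierstrassCurve.geomTorsion A (2 : ℤ),
        ∀ (σ : Field.absoluteGaloisGroup ℚ) (P : WeierstrassCurve.geomTorsion W (2 : ℤ)), e (σ • P) = σ • e P) →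
      ∀ (κ : ZpExtension ℚ 2) (γ : Field.absoluteGaloisGroup ℚ), κ.IsCyclotomic → κ.IsTopGenerator γ →
      ((∃ D' : SignedSelmerDualData A κ γ 1, Module.Finite (IwasawaAlgebra 2) D'.X) →
        {s : signedSelmerInfty A κ 1 | 2 • s = 0}.Finite) →
      (∃ D : SignedSelmerDualData W κ γ 1, Module.Finite (IwasawaAlgebra 2) D.X) →
      {s : signedSelmerInfty W κ 1 | 2 • s = 0}.Finite) :
    SignedMuPropagationAtTwo := by
  intro W _ _ A _ _ hssW haW hssA haA hiso hA κ γ hκ hγ D hD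
  refine (isTorsion_and_mu_eq_zero_iff_finite_selmer_pTorsion D).mpr
    (hsel2 W A hssW haW hssA haA hiso κ γ hκ hγ ?_ ⟨D, hD⟩)
  rintro ⟨D', hD'⟩
  exact (isTorsion_and_mu_eq_zero_iff_finite_selmer_pTorsion D').mp (hA κ γ hκ hγ D')

/-- **SEL2-SEED ⇒ `SignedMuSeedAtTwoPlus`** (child 21438): if every habitat⁺ curve is congruent mod `2` to SOME
good-supersingular `a₂ = 0` curve `A/ℚ` such that, at every cyclotomic `(κ, γ)`, `X⁺(A)` f.g. ⇒ `Sel⁺(A/ℚ_∞)[2]`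
finite, then the `μ`-seed child holds. [cite: GreenbergVatsal2000, p. 3 (proof of Thm. (1.4))] -/
theorem signedMuSeedAtTwoPlus_of_sel2Seed
    (hseed : ∀ (W : WeierstrassCurve ℚ) [W.IsElliptic] [W.IsGloballyMinimal], ¬ W.HasCM → W.analyticRank = 0 →
      GoodSS W 2 → W.frobeniusTrace 2 = 0 → W.Δ < 0 →
      ∃ (A : WeierstrassCurve ℚ) (_ : A.IsElliptic) (_ : A.IsGloballyMinimal), GoodSS A 2 ∧ A.frobeniusTrace 2 = 0 ∧
        (∃ e : WeierstrassCurve.geomTorsion W (2 : ℤ) ≃+ WeierstrassCurve.geomTorsion A (2 : ℤ),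
          ∀ (σ : Field.absoluteGaloisGroup ℚ) (P : WeierstrassCurve.geomTorsion W (2 : ℤ)), e (σ • P) = σ • e P) ∧
        ∀ (κ : ZpExtension ℚ 2) (γ : Field.absoluteGaloisGroup ℚ), κ.IsCyclotomic → κ.IsTopGenerator γ →
          (∃ D' : SignedSelmerDualData A κ γ 1, Module.Finite (IwasawaAlgebra 2) D'.X) →
          {s : signedSelmerInfty A κ 1 | 2 • s = 0}.Finite) :
    SignedMuSeedAtTwoPlus := by
  intro W _ _ hCM hr hss ha hΔ
  obtain ⟨A, hAell, hAmin, hssA, haA, hiso, hfinA⟩ := hseed W hCM hr hss ha hΔ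
  exact ⟨A, hAell, hAmin, hssA, haA, hiso,
    fun κ γ hκ hγ D' hD' ↦ (isTorsion_and_mu_eq_zero_iff_finite_selmer_pTorsion D').mpr (hfinA κ γ hκ hγ ⟨D', hD'⟩)⟩

/-- **NECESSITY of the seed child**: `SignedMuVanishingAtTwoPlus ⇒ SignedMuSeedAtTwoPlus` — take `A := W` with the
identity of `W[2]` (so, of the split {21437 analytic, 21438 seed, 21439 propagation}, the parent implies 21437 and
21438; only the propagation child quantifies beyond the habitat⁺). [folklore] -/
theorem signedMuSeedAtTwoPlus_of_signedMuVanishingAtTwoPlus (h : SignedMuVanishingAtTwoPlus) :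
    SignedMuSeedAtTwoPlus := by
  intro W hW hW' hCM hr hss ha hΔ
  exact ⟨W, hW, hW', hss, ha, ⟨AddEquiv.refl _, fun _ _ ↦ rfl⟩, (h W hCM hr hss ha hΔ).1⟩

/-- **The crux from SEL2 ∧ (PER) ∧ (FLAT)** — the line `birth` v3 with its algebraic stub in Selmer-group currency
(SEL2 ⇒ `MuAlgebraicZero` by §2; the analytic half from the period unit and `2 ∤ L♭` by the lead's p572526).
[cite: GreenbergVatsal2000, p. 2–3] [cite: Pollack2003, Prop. 6.18] -/
theorem signedMuVanishingAtTwoPlus_of_sel2Finite_of_periodUnit_of_flatMuZero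
    (hsel2 : ∀ (W : WeierstrassCurve ℚ) [W.IsElliptic] [W.IsGloballyMinimal], ¬ W.HasCM → W.analyticRank = 0 →
      GoodSS W 2 → W.frobeniusTrace 2 = 0 → W.Δ < 0 →
      ∀ (κ : ZpExtension ℚ 2) (γ : Field.absoluteGaloisGroup ℚ), κ.IsCyclotomic → κ.IsTopGenerator γ →
      (∃ D : SignedSelmerDualData W κ γ 1, Module.Finite (IwasawaAlgebra 2) D.X) →
      {s : signedSelmerInfty W κ 1 | 2 • s = 0}.Finite)
    (hper : ∀ (W : WeierstrassCurve ℚ) [W.IsElliptic] [W.IsGloballyMinimal], GoodSS W 2 →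
      ∀ [NeZero (W.conductorNorm ℤ)] (f : CuspForm (Gamma0 (W.conductorNorm ℤ)) 2), IsNewformOf W f →
      ∃ u : ℚ, ‖(u : ℚ_[2])‖ = 1 ∧ W.realPeriodRat = u * plusPeriod f)
    (hflat : ∀ (W : WeierstrassCurve ℚ) [W.IsElliptic] [W.IsGloballyMinimal], ¬ W.HasCM →
      W.analyticRank = 0 → GoodSS W 2 → W.frobeniusTrace 2 = 0 → W.Δ < 0 →
      ∀ [NeZero (W.conductorNorm ℤ)] (f : CuspForm (Gamma0 (W.conductorNorm ℤ)) 2), IsNewformOf W f →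
      ∀ (Lplus Lminus : IwasawaAlgebra 2), IsPollackPair f 2 Lplus Lminus →
      ¬ PowerSeries.C (2 : ℤ_[2]) ∣ Lminus) :
    SignedMuVanishingAtTwoPlus := by
  intro W _ _ hCM hr hss ha hΔ
  exact ⟨muAlgebraic_iff_sel2Finite.mpr hsel2 W hCM hr hss ha hΔ,
    signedMuAnalyticAtTwoPlus_of_periodUnit_of_flatMuZero hper hflat W hCM hr hss ha hΔ⟩

end Summit.BirchSwinnertonDyer.BirchSwinnertonDyer.Theorems.SignedMuAtTwo

end
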